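import Summits.HubbardSuperconductivity.HubbardSuperconductivity.Theorems.AnisotropyChordTransferFibre3LatticeEnergy
import Summits.HubbardSuperconductivity.HubbardSuperconductivity.Theorems.AnisotropyChordTransferFibre3KT2bSupports
import Literature.Probability.LatticeModels.TorusHeatKernel1D

/-!
# Route `AnisotropyChord` / H0 rotor rung: `DenMinRestLattice` PROVED — off the poles and the low shell `Σε ≥ (5 + 2cos θ)ε₁` (`L ≥ 8`)

PartN32 (`…Fibre3KT2bTargets`), memo ROTOR-THEORY-21 §306 (theory seat `hubbard-h0-rotor-theory-1`): the finite case analysis on the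
integer representatives `(x_i, y_i) = valMinAbs` of the three momenta `k₁ = K₁ − k₂ − k₃, k₂, k₃` (`Σx ≡ 1`, `Σy ≡ 0`):
(i) a coordinate with `|r| ≥ 3` forces another nonzero coordinate on the same axis, so `Σε ≥ ε₁[(1+2c)² + 1] ≥ (5+2c)ε₁`
(`4c² + 2c − 3 ≥ 0` for `c = cos θ ≥ √2/2 ⟸ L ≥ 8`); (ii) otherwise all `|r| ≤ 2`, the integer sums are exactly `(1,0)`, and the
x- and y-triples fall into four classes each (`tripleX`, `tripleY`, by exhaustion); every combination is a pole, or has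
`Σε < 5.5ε₁` (low shell), or `Σε ≥ (3 + 2(1+c))ε₁ = (5+2c)ε₁`.  Consequences (with `…KT2bSupports`):
**`denMinRestLattice_holds : DenMinRestLattice L`**, **`denMinRestClosed_holds : DenMinRestClosed L Δ`**,
**`denMinRest_closedForm`: `8 ≤ L → Δ ≤ 1 → DenMinRest L Δ (2 + cos(2π/L))`**.
Prover seat `hubbard-h0-rotor-p1` g22; helper for stmt-HubbardSuperconductivity-19089 (`--supports`).
-/

set_option linter.dupNamespace false
set_option autoImplicit false

noncomputable section

open scoped BigOperators

namespace Summit.HubbardSuperconductivity.HubbardSuperconductivity.Theorems.AnisotropyChord.Transfer.Fibre3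

variable (L : ℕ) [NeZero L]

/-! ## Small representatives: counts and energies -/

/-- indicator of `|r| = 1`. [folklore] -/
def n1 (r : ℤ) : ℕ := if r = 1 ∨ r = -1 then 1 else 0
/-- indicator of `|r| = 2`. [folklore] -/
def n2 (r : ℤ) : ℕ := if r = 2 ∨ r = -2 then 1 else 0

omit [NeZero L] in
/-- for `|r| ≤ 2`: `wInt r = n1(r)·ε₁ + n2(r)·2(1+c)ε₁`. [folklore] -/
theorem wInt_small (r : ℤ) (hr : |r| ≤ 2) :
    wInt L r = (n1 r : ℝ) * eps1 L + (n2 r : ℝ) * (2 * (1 + Real.cos (2 * Real.pi / L)) * eps1 L) := by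
  have h1 := wInt_one L
  have h2 := wInt_two L
  have h0 := wInt_zero L
  have hm1 : wInt L (-1) = eps1 L := by rw [wInt_neg, h1]
  have hm2 : wInt L (-2) = 2 * (1 + Real.cos (2 * Real.pi / L)) * eps1 L := by rw [wInt_neg, h2]
  rw [abs_le] at hr
  obtain ⟨hr1, hr2⟩ := hr
  interval_cases r
  · rw [hm2]; simp [n1, n2]
  · rw [hm1]; simp [n1, n2]
  · rw [h0]; simp [n1, n2]
  · rw [h1]; simp [n1, n2]
  · rw [h2]; simp [n1, n2]

/-- classification of small `x`-triples with integer sum `1`. [folklore] -/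
theorem tripleX (a b d : ℤ) (ha : |a| ≤ 2) (hb : |b| ≤ 2) (hd : |d| ≤ 2) (hs : a + b + d = 1) :
    (n1 a + n1 b + n1 d = 1 ∧ n2 a + n2 b + n2 d = 0)
    ∨ (n1 a + n1 b + n1 d = 3 ∧ n2 a + n2 b + n2 d = 0)
    ∨ (n1 a + n1 b + n1 d = 1 ∧ n2 a + n2 b + n2 d = 1)
    ∨ (n1 a + n1 b + n1 d = 1 ∧ n2 a + n2 b + n2 d = 2) := by
  rw [abs_le] at ha hb hd
  obtain ⟨ha1, ha2⟩ := ha; obtain ⟨hb1, hb2⟩ := hb; obtain ⟨hd1, hd2⟩ := hd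
  interval_cases a <;> interval_cases b <;> interval_cases d <;> first | omega | decide

/-- classification of small `y`-triples with integer sum `0`. [folklore] -/
theorem tripleY (a b d : ℤ) (ha : |a| ≤ 2) (hb : |b| ≤ 2) (hd : |d| ≤ 2) (hs : a + b + d = 0) :
    (n1 a + n1 b + n1 d = 0 ∧ n2 a + n2 b + n2 d = 0)
    ∨ (n1 a + n1 b + n1 d = 2 ∧ n2 a + n2 b + n2 d = 0)
    ∨ (n1 a + n1 b + n1 d = 0 ∧ n2 a + n2 b + n2 d = 2)
    ∨ (n1 a + n1 b + n1 d = 2 ∧ n2 a + n2 b + n2 d = 1) := by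
  rw [abs_le] at ha hb hd
  obtain ⟨ha1, ha2⟩ := ha; obtain ⟨hb1, hb2⟩ := hb; obtain ⟨hd1, hd2⟩ := hd
  interval_cases a <;> interval_cases b <;> interval_cases d <;> first | omega | decide

/-! ## Large representatives -/

omit [NeZero L] in
/-- an integer congruent to `t` with `|r| ≤ L/2`, `|t| ≤ 1`, `L ≥ 4`, equals `t`. [folklore] -/
theorem int_eq_of_modEq {r t : ℤ} (hr : 2 * |r| ≤ (L : ℤ)) (ht : |t| ≤ 1) (hL : 4 ≤ L)
    (h : ((r : ℤ) : ZMod L) = ((t : ℤ) : ZMod L)) : r = t := by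
  have hdvd : (L : ℤ) ∣ r - t := by
    rw [← ZMod.intCast_zmod_eq_zero_iff_dvd, Int.cast_sub, h, sub_self]
  have hlt : |r - t| < (L : ℤ) := by
    have hL' : (4 : ℤ) ≤ L := by exact_mod_cast hL
    have := abs_sub r t
    linarith [abs_nonneg r]
  have := Int.eq_zero_of_abs_lt_dvd hdvd hlt
  linarith

omit [NeZero L] in
/-- the `x`-axis, large case: `3 ≤ |x₁|` with `x₁ + x₂ + x₃ ≡ 1` ⇒ `wInt x₁ + wInt x₂ + wInt x₃ ≥ (5 + 2c)ε₁` (`L ≥ 8`). [folklore] -/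
theorem axisX_large (hL : 8 ≤ L) {x₁ x₂ x₃ : ℤ} (h1 : 2 * |x₁| ≤ (L : ℤ)) (h2 : 2 * |x₂| ≤ (L : ℤ)) (h3 : 2 * |x₃| ≤ (L : ℤ))
    (hs : ((x₁ + x₂ + x₃ : ℤ) : ZMod L) = 1) (hbig : 3 ≤ |x₁|) :
    (5 + 2 * Real.cos (2 * Real.pi / L)) * eps1 L ≤ wInt L x₁ + wInt L x₂ + wInt L x₃ := by
  have hL0 : 0 < L := by omega
  have hε : 0 ≤ eps1 L := by unfold eps1; linarith [Real.cos_le_one (2 * Real.pi / L)]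
  have hkey := key_ineq (sqrt2_div_two_le_cos L hL)
  have hA := wInt_three_le L hbig h1 hL0
  -- another nonzero coordinate
  have hother : x₂ ≠ 0 ∨ x₃ ≠ 0 := by
    by_contra h
    push Not at h
    obtain ⟨h2z, h3z⟩ := h
    rw [h2z, h3z, add_zero, add_zero] at hs
    have := int_eq_of_modEq L h1 (by norm_num) (by omega) (t := 1) (by push_cast at hs ⊢; exact hs)
    rw [this] at hbig; norm_num at hbig
  rcases hother with hx | hx
  · have hB := eps1_le_wInt L hx h2 hL0
    nlinarith [wInt_nonneg L x₃]
  · have hB := eps1_le_wInt L hx h3 hL0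
    nlinarith [wInt_nonneg L x₂]

omit [NeZero L] in
/-- the `y`-axis, large case: `3 ≤ |y₁|` with `y₁ + y₂ + y₃ ≡ 0` ⇒ the same bound. [folklore] -/
theorem axisY_large (hL : 8 ≤ L) {y₁ y₂ y₃ : ℤ} (h1 : 2 * |y₁| ≤ (L : ℤ)) (h2 : 2 * |y₂| ≤ (L : ℤ)) (h3 : 2 * |y₃| ≤ (L : ℤ))
    (hs : ((y₁ + y₂ + y₃ : ℤ) : ZMod L) = 0) (hbig : 3 ≤ |y₁|) :
    (5 + 2 * Real.cos (2 * Real.pi / L)) * eps1 L ≤ wInt L y₁ + wInt L y₂ + wInt L y₃ := by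
  have hL0 : 0 < L := by omega
  have hε : 0 ≤ eps1 L := by unfold eps1; linarith [Real.cos_le_one (2 * Real.pi / L)]
  have hkey := key_ineq (sqrt2_div_two_le_cos L hL)
  have hA := wInt_three_le L hbig h1 hL0
  have hother : y₂ ≠ 0 ∨ y₃ ≠ 0 := by
    by_contra h
    push Not at h
    obtain ⟨h2z, h3z⟩ := h
    rw [h2z, h3z, add_zero, add_zero] at hs
    have := int_eq_of_modEq L h1 (by norm_num) (by omega) (t := 0) (by push_cast at hs ⊢; exact hs)
    rw [this] at hbig; norm_num at hbig
  rcases hother with hy | hy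
  · have hB := eps1_le_wInt L hy h2 hL0
    nlinarith [wInt_nonneg L y₃]
  · have hB := eps1_le_wInt L hy h3 hL0
    nlinarith [wInt_nonneg L y₂]

/-! ## The sixteen small combinations -/

omit [NeZero L] in
/-- the sixteen combinations of small classes (energies in units of `ε₁`): `X + Y ≥ 5.5 ⇒ X + Y ≥ 5 + 2c` for `0 ≤ c ≤ 1`. [folklore] -/
theorem combo_classes {c X Y : ℝ} (hc0 : 0 ≤ c) (hc1 : c ≤ 1)
    (hX : X = 1 ∨ X = 3 ∨ X = 3 + 2 * c ∨ X = 5 + 4 * c)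
    (hY : Y = 0 ∨ Y = 2 ∨ Y = 4 + 4 * c ∨ Y = 4 + 2 * c)
    (h : 5.5 ≤ X + Y) : 5 + 2 * c ≤ X + Y := by
  rcases hX with rfl | rfl | rfl | rfl <;> rcases hY with rfl | rfl | rfl | rfl <;> linarith

/-! ## The lattice lemma -/

/-- **`DenMinRestLattice` holds.** [folklore] -/
theorem denMinRestLattice_holds : DenMinRestLattice L := by
  intro hL k₂ k₃ hpole hlow
  have hL0 : 0 < L := by omega
  have hc0 : 0 ≤ Real.cos (2 * Real.pi / L) := le_trans (by positivity) (sqrt2_div_two_le_cos L hL)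
  have hc1 : Real.cos (2 * Real.pi / L) ≤ 1 := Real.cos_le_one _
  have hε : 0 < eps1 L := eps1_pos L (by omega)
  -- the free energy is ≥ 5.5 ε₁ (not in the low shell)
  have hfree : 5.5 * eps1 L ≤ epsT L (K1 L - k₂ - k₃) + epsT L k₂ + epsT L k₃ := by
    by_contra h
    exact hlow ⟨hpole, lt_of_not_ge h⟩
  -- representatives
  set k₁ := K1 L - k₂ - k₃ with hk₁
  obtain ⟨x₁, hx₁⟩ : ∃ x : ℤ, k₁.1.valMinAbs = x := ⟨_, rfl⟩
  obtain ⟨x₂, hx₂⟩ : ∃ x : ℤ, k₂.1.valMinAbs = x := ⟨_, rfl⟩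
  obtain ⟨x₃, hx₃⟩ : ∃ x : ℤ, k₃.1.valMinAbs = x := ⟨_, rfl⟩
  obtain ⟨y₁, hy₁⟩ : ∃ y : ℤ, k₁.2.valMinAbs = y := ⟨_, rfl⟩
  obtain ⟨y₂, hy₂⟩ : ∃ y : ℤ, k₂.2.valMinAbs = y := ⟨_, rfl⟩
  obtain ⟨y₃, hy₃⟩ : ∃ y : ℤ, k₃.2.valMinAbs = y := ⟨_, rfl⟩
  have bx₁ : 2 * |x₁| ≤ (L : ℤ) := hx₁ ▸ Literature.Probability.LatticeModels.two_mul_abs_valMinAbs_le k₁.1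
  have bx₂ : 2 * |x₂| ≤ (L : ℤ) := hx₂ ▸ Literature.Probability.LatticeModels.two_mul_abs_valMinAbs_le k₂.1
  have bx₃ : 2 * |x₃| ≤ (L : ℤ) := hx₃ ▸ Literature.Probability.LatticeModels.two_mul_abs_valMinAbs_le k₃.1
  have by₁ : 2 * |y₁| ≤ (L : ℤ) := hy₁ ▸ Literature.Probability.LatticeModels.two_mul_abs_valMinAbs_le k₁.2
  have by₂ : 2 * |y₂| ≤ (L : ℤ) := hy₂ ▸ Literature.Probability.LatticeModels.two_mul_abs_valMinAbs_le k₂.2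
  have by₃ : 2 * |y₃| ≤ (L : ℤ) := hy₃ ▸ Literature.Probability.LatticeModels.two_mul_abs_valMinAbs_le k₃.2
  have hE : epsT L k₁ + epsT L k₂ + epsT L k₃
      = (wInt L x₁ + wInt L x₂ + wInt L x₃) + (wInt L y₁ + wInt L y₂ + wInt L y₃) := by
    rw [epsT_eq_wInt, epsT_eq_wInt, epsT_eq_wInt, hx₁, hx₂, hx₃, hy₁, hy₂, hy₃]; ring
  have hk1 : k₁.1 + k₂.1 + k₃.1 = 1 := by
    rw [hk₁, Prod.fst_sub, Prod.fst_sub]; simp only [K1]; ring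
  have hk2 : k₁.2 + k₂.2 + k₃.2 = 0 := by
    rw [hk₁, Prod.snd_sub, Prod.snd_sub]; simp only [K1]; ring
  have hsx : ((x₁ + x₂ + x₃ : ℤ) : ZMod L) = 1 := by
    rw [← hx₁, ← hx₂, ← hx₃]; push_cast; exact hk1
  have hsy : ((y₁ + y₂ + y₃ : ℤ) : ZMod L) = 0 := by
    rw [← hy₁, ← hy₂, ← hy₃]; push_cast; exact hk2
  have hX0 : 0 ≤ wInt L x₁ + wInt L x₂ + wInt L x₃ := by
    have := wInt_nonneg L x₁; have := wInt_nonneg L x₂; have := wInt_nonneg L x₃; linarith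
  have hY0 : 0 ≤ wInt L y₁ + wInt L y₂ + wInt L y₃ := by
    have := wInt_nonneg L y₁; have := wInt_nonneg L y₂; have := wInt_nonneg L y₃; linarith
  rw [hE] at hfree ⊢
  -- Case A: a large coordinate
  by_cases hA : 3 ≤ |x₁| ∨ 3 ≤ |x₂| ∨ 3 ≤ |x₃| ∨ 3 ≤ |y₁| ∨ 3 ≤ |y₂| ∨ 3 ≤ |y₃|
  · rcases hA with h | h | h | h | h | h
    · have := axisX_large L hL bx₁ bx₂ bx₃ hsx h; linarith
    · have := axisX_large L hL bx₂ bx₁ bx₃ (by rw [show x₂ + x₁ + x₃ = x₁ + x₂ + x₃ by ring]; exact hsx) h; linarith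
    · have := axisX_large L hL bx₃ bx₁ bx₂ (by rw [show x₃ + x₁ + x₂ = x₁ + x₂ + x₃ by ring]; exact hsx) h; linarith
    · have := axisY_large L hL by₁ by₂ by₃ hsy h; linarith
    · have := axisY_large L hL by₂ by₁ by₃ (by rw [show y₂ + y₁ + y₃ = y₁ + y₂ + y₃ by ring]; exact hsy) h; linarith
    · have := axisY_large L hL by₃ by₁ by₂ (by rw [show y₃ + y₁ + y₂ = y₁ + y₂ + y₃ by ring]; exact hsy) h; linarith
  -- Case B: all representatives are small
  push Not at hA
  obtain ⟨a1, a2, a3, a4, a5, a6⟩ := hA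
  have sx₁ : |x₁| ≤ 2 := by omega
  have sx₂ : |x₂| ≤ 2 := by omega
  have sx₃ : |x₃| ≤ 2 := by omega
  have sy₁ : |y₁| ≤ 2 := by omega
  have sy₂ : |y₂| ≤ 2 := by omega
  have sy₃ : |y₃| ≤ 2 := by omega
  have hL' : (8 : ℤ) ≤ L := by exact_mod_cast hL
  -- exact integer sums
  have hsumx : x₁ + x₂ + x₃ = 1 := by
    have hdvd : (L : ℤ) ∣ (x₁ + x₂ + x₃) - 1 := by
      rw [← ZMod.intCast_zmod_eq_zero_iff_dvd, Int.cast_sub, hsx]; simp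
    have hlt : |(x₁ + x₂ + x₃) - 1| < (L : ℤ) := by
      rw [abs_lt]; rw [abs_le] at sx₁ sx₂ sx₃; constructor <;> omega
    have := Int.eq_zero_of_abs_lt_dvd hdvd hlt
    omega
  have hsumy : y₁ + y₂ + y₃ = 0 := by
    have hdvd : (L : ℤ) ∣ (y₁ + y₂ + y₃) := by
      rw [← ZMod.intCast_zmod_eq_zero_iff_dvd, hsy]
    have hlt : |y₁ + y₂ + y₃| < (L : ℤ) := by
      rw [abs_lt]; rw [abs_le] at sy₁ sy₂ sy₃; constructor <;> omega
    exact Int.eq_zero_of_abs_lt_dvd hdvd hlt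
  -- energies in units of ε₁
  obtain ⟨X, hXdef⟩ : ∃ X : ℝ,
      X = ((n1 x₁ + n1 x₂ + n1 x₃ : ℕ) : ℝ) + ((n2 x₁ + n2 x₂ + n2 x₃ : ℕ) : ℝ) * (2 * (1 + Real.cos (2 * Real.pi / L))) :=
    ⟨_, rfl⟩
  obtain ⟨Y, hYdef⟩ : ∃ Y : ℝ,
      Y = ((n1 y₁ + n1 y₂ + n1 y₃ : ℕ) : ℝ) + ((n2 y₁ + n2 y₂ + n2 y₃ : ℕ) : ℝ) * (2 * (1 + Real.cos (2 * Real.pi / L))) :=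
    ⟨_, rfl⟩
  have eX : wInt L x₁ + wInt L x₂ + wInt L x₃ = X * eps1 L := by
    rw [hXdef, wInt_small L x₁ sx₁, wInt_small L x₂ sx₂, wInt_small L x₃ sx₃]; push_cast; ring
  have eY : wInt L y₁ + wInt L y₂ + wInt L y₃ = Y * eps1 L := by
    rw [hYdef, wInt_small L y₁ sy₁, wInt_small L y₂ sy₂, wInt_small L y₃ sy₃]; push_cast; ring
  -- the classes
  have hXc : X = 1 ∨ X = 3 ∨ X = 3 + 2 * Real.cos (2 * Real.pi / L) ∨ X = 5 + 4 * Real.cos (2 * Real.pi / L) := by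
    rcases tripleX x₁ x₂ x₃ sx₁ sx₂ sx₃ hsumx with ⟨h1, h2⟩ | ⟨h1, h2⟩ | ⟨h1, h2⟩ | ⟨h1, h2⟩
    · exact Or.inl (by rw [hXdef, h1, h2]; push_cast; ring)
    · exact Or.inr (Or.inl (by rw [hXdef, h1, h2]; push_cast; ring))
    · exact Or.inr (Or.inr (Or.inl (by rw [hXdef, h1, h2]; push_cast; ring)))
    · exact Or.inr (Or.inr (Or.inr (by rw [hXdef, h1, h2]; push_cast; ring)))
  have hYc : Y = 0 ∨ Y = 2 ∨ Y = 4 + 4 * Real.cos (2 * Real.pi / L) ∨ Y = 4 + 2 * Real.cos (2 * Real.pi / L) := by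
    rcases tripleY y₁ y₂ y₃ sy₁ sy₂ sy₃ hsumy with ⟨h1, h2⟩ | ⟨h1, h2⟩ | ⟨h1, h2⟩ | ⟨h1, h2⟩
    · exact Or.inl (by rw [hYdef, h1, h2]; push_cast; ring)
    · exact Or.inr (Or.inl (by rw [hYdef, h1, h2]; push_cast; ring))
    · exact Or.inr (Or.inr (Or.inl (by rw [hYdef, h1, h2]; push_cast; ring)))
    · exact Or.inr (Or.inr (Or.inr (by rw [hYdef, h1, h2]; push_cast; ring)))
  rw [eX, eY] at hfree ⊢
  -- divide by ε₁ > 0, apply the sixteen-case lemma, multiply back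
  have h55 : 5.5 ≤ X + Y := by
    by_contra hh
    push Not at hh
    nlinarith
  have hfin := combo_classes hc0 hc1 hXc hYc h55
  nlinarith

/-- **`DenMinRestClosed L Δ` holds.** [folklore] -/
theorem denMinRestClosed_holds (Δ : ℝ) : DenMinRestClosed L Δ :=
  denMinRestClosed_of_lattice L (denMinRestLattice_holds L) Δ

/-- **`DenMinRest L Δ (2 + cos(2π/L))` for `L ≥ 8`, `Δ ≤ 1`** — the closed-form rest denominator of memo 21 §306. [folklore] -/
theorem denMinRest_closedForm (hL : 8 ≤ L) {Δ : ℝ} (hΔ : Δ ≤ 1) : DenMinRest L Δ (2 + Real.cos (2 * Real.pi / L)) :=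
  denMinRest_of_lattice L (denMinRestLattice_holds L) hL hΔ

end Summit.HubbardSuperconductivity.HubbardSuperconductivity.Theorems.AnisotropyChord.Transfer.Fibre3

end
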